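import Mathlib
import Summits.ValiantsHypothesis.ValiantsHypothesis.Theorems.ValuativeGCTValuativeFlipCyclicMembershipT

/-!
# Membership of the counter-clockwise pure products in the tangent span (crux `ValuativeGCT.ValuativeFlip`, stub `stub_fourRowPencilRank`)

P2 (counter-clockwise half) of the cyclic-tridiagonal architecture for hypothesis `H` of
`fourRowPencilRank_of_pencilCertificate` (`Cruxes/ValuativeFlip/AxisK9G1a2CyclicTridiagonal.md` §3),
the mirror image of file `…CyclicMembershipT`: for the window `[q, q+e]` the counter-clockwise
piece `Sw q e` sits in the cofactor `cofF q (q+e) = Tw (q+e) (n-e) + Sw q e`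
(`cofF_eq_Tw_add_Sw'`), and

* `lin_mul_Sw_mem` — **for every even `e = 2e'+2 ≤ n-3`, every `q` and every linear form `λ`:
  `λ · Sw q e ∈ tanV`**, provided the four forms `l_q, l_{q+e}, m_q, m_{q+e-1}` span the linear
  forms (hypothesis `hspan`; true for the explicit configuration).  Induction on `e'` exactly as in
  the clockwise file, with the roles of the `Tw`/`Sw` three-term identities exchanged: now the
  `Sw_rowRec`/`Sw_colRec` identity produces the factor `2` and the `Tw_rowRec`/`Tw_colRec`
  identity cancels the clockwise parts.

[this crux]
-/

set_option linter.dupNamespace false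

namespace Summit.ValiantsHypothesis.ValiantsHypothesis.Theorems.ValuativeFlip

open MvPolynomial
open scoped BigOperators

noncomputable section

section zshift

variable {n : ℕ}

/-- Index bookkeeping in `ZMod n`: `q + a + b = q` when `a + b = n`. -/
theorem zsh_zero (q : ZMod n) {a b : ℕ} (h : a + b = n) :
    q + (a : ZMod n) + (b : ZMod n) = q := by
  have h' := congrArg (Nat.cast : ℕ → ZMod n) h
  push_cast at h'
  rw [ZMod.natCast_self] at h'
  linear_combination h'

/-- Index bookkeeping in `ZMod n`: `q + a + b = q + 1` when `a + b = n + 1`. -/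
theorem zsh_one (q : ZMod n) {a b : ℕ} (h : a + b = n + 1) :
    q + (a : ZMod n) + (b : ZMod n) = q + 1 := by
  have h' := congrArg (Nat.cast : ℕ → ZMod n) h
  push_cast at h'
  rw [ZMod.natCast_self] at h'
  linear_combination h'

/-- Index bookkeeping in `ZMod n`: `q + a + b = q + 2` when `a + b = n + 2`. -/
theorem zsh_two (q : ZMod n) {a b : ℕ} (h : a + b = n + 2) :
    q + (a : ZMod n) + (b : ZMod n) = q + 2 := by
  have h' := congrArg (Nat.cast : ℕ → ZMod n) h
  push_cast at h'
  rw [ZMod.natCast_self] at h'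
  linear_combination h'

/-- Index bookkeeping in `ZMod n`: `q + a + b = q - 1` when `a + b + 1 = n`. -/
theorem zsh_neg_one (q : ZMod n) {a b : ℕ} (h : a + b + 1 = n) :
    q + (a : ZMod n) + (b : ZMod n) = q - 1 := by
  have h' := congrArg (Nat.cast : ℕ → ZMod n) h
  push_cast at h'
  rw [ZMod.natCast_self] at h'
  linear_combination h'

end zshift

section chainS

variable {K : Type*} [Field K] {n : ℕ} [NeZero n] (l m m' : ZMod n → MvPolynomial (Fin 4) K)

/-- The cofactor formula in the counter-clockwise window form:
`cofF q (q+f) = Tw (q+f) (n-f) + Sw q f` for `1 ≤ f ≤ n-1` (`n ≥ 3`). [this crux] -/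
theorem cofF_eq_Tw_add_Sw' (hn3 : 3 ≤ n) (q : ZMod n) (f : ℕ) (hf1 : 1 ≤ f) (hfn : f + 1 ≤ n) :
    cofF l m m' q (q + (f : ZMod n)) = Tw l m m' (q + (f : ZMod n)) (n - f) + Sw l m m' q f := by
  have := cofF_eq_Tw_add_Sw l m m' hn3 (q + (f : ZMod n)) (n - f) (by omega) (by omega)
  rwa [zsh_zero q (by omega), show n - (n - f) = f by omega] at this

/-- The diagonal cofactor, counter-clockwise form: `cofF q q = Sw q 0`. [this crux] -/
theorem cofF_diag' (hn3 : 3 ≤ n) (q : ZMod n) : cofF l m m' q q = Sw l m m' q 0 := by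
  rw [cofF_diag l m m' hn3, Tw_zero, Sw_zero]

/-- **Counter-clockwise membership chain.**  For `2 ≠ 0` in `K`, linear forms `l m m'`, and the
span hypothesis on the four special multipliers `l_q, l_{q+e}, m_q, m_{q+e-1}`, every linear
multiple of a counter-clockwise pure product of even string length `2e'+2 ≤ n-3` lies in the
tangent span. [this crux] -/
theorem lin_mul_Sw_mem (hn3 : 3 ≤ n) (h2 : (2 : K) ≠ 0)
    (hl : ∀ r, l r ∈ linL K) (hm : ∀ r, m r ∈ linL K) (hm' : ∀ r, m' r ∈ linL K)
    (hspan : ∀ (q : ZMod n) (e : ℕ), 2 ≤ e → e + 3 ≤ n →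
      linL K ≤ Submodule.span K
        ({l q, l (q + (e : ZMod n)), m q, m (q + ((e - 1 : ℕ) : ZMod n))} :
          Set (MvPolynomial (Fin 4) K))) :
    ∀ e' : ℕ, 2 * e' + 2 + 3 ≤ n → ∀ (q : ZMod n) (lam : MvPolynomial (Fin 4) K), lam ∈ linL K →
      lam * Sw l m m' q (2 * e' + 2) ∈ tanV l m m' := by
  -- uniform notation: the window `[q, q+e]`, `J = q + e`; cofactors `cofF p (p+f)` for all `f ≥ 1`
  have G : ∀ f : ℕ, 1 ≤ f → f + 1 ≤ n → ∀ p : ZMod n,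
      cofF l m m' p (p + (f : ZMod n)) = Tw l m m' (p + (f : ZMod n)) (n - f) + Sw l m m' p f :=
    fun f hf1 hfn p => cofF_eq_Tw_add_Sw' l m m' hn3 p f hf1 hfn
  intro e'
  induction e' with
  | zero =>
    intro hn q lam hlam
    -- e = 2: window `[q, q+2]`
    have G0 : cofF l m m' q (q + 2) = Tw l m m' (q + 2) (n - 2) + Sw l m m' q 2 := by
      simpa using G 2 (by norm_num) (by omega) q
    have Gm : cofF l m m' (q - 1) (q + 2) = Tw l m m' (q + 2) (n - 3) + Sw l m m' (q - 1) 3 := by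
      have := G 3 (by norm_num) (by omega) (q - 1)
      rwa [show q - 1 + ((3 : ℕ) : ZMod n) = q + 2 by push_cast; ring] at this
    have Gp : cofF l m m' (q + 1) (q + 2) = Tw l m m' (q + 2) (n - 1) + Sw l m m' (q + 1) 1 := by
      have := G 1 le_rfl (by omega) (q + 1)
      rwa [show q + 1 + ((1 : ℕ) : ZMod n) = q + 2 by push_cast; ring] at this
    have GJp : cofF l m m' q (q + 3) = Tw l m m' (q + 3) (n - 3) + Sw l m m' q 3 := by
      simpa using G 3 (by norm_num) (by omega) q
    have GJm : cofF l m m' q (q + 1) = Tw l m m' (q + 1) (n - 1) + Sw l m m' q 1 := by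
      simpa using G 1 le_rfl (by omega) q
    have GJJ : cofF l m m' (q + 2) (q + 2) = Sw l m m' (q + 2) 0 := cofF_diag' l m m' hn3 _
    have Gii : cofF l m m' q q = Sw l m m' q 0 := cofF_diag' l m m' hn3 _
    -- the identities, with numerals normalised
    have S1 : m' (q + 1) * Sw l m m' (q + 1) 1 =
        l q * Sw l m m' q 2 + m (q - 1) * Sw l m m' (q - 1) 3 := by
      have := Sw_rowRec l m m' (q + 1) 1 (by omega)
      rwa [show (q + 1 - 1 : ZMod n) = q by ring, show (q + 1 - 2 : ZMod n) = q - 1 by ring] at this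
    have T1 : m (q - 1) * Tw l m m' (q + 2) (n - 3) =
        l q * Tw l m m' (q + 2) (n - 2) + m' (q + 1) * Tw l m m' (q + 2) (n - 1) := by
      have := Tw_rowRec l m m' (q + 2) (n - 3) (by omega)
      rw [show n - 3 + 1 = n - 2 by omega, show n - 3 + 2 = n - 1 by omega] at this
      rwa [show q + 2 + ((n - 3 : ℕ) : ZMod n) = q - 1 by
          simpa using zsh_neg_one q (a := 2) (b := n - 3) (by omega),
        show q + 2 + ((n - 2 : ℕ) : ZMod n) = q by
          simpa using zsh_zero q (a := 2) (b := n - 2) (by omega),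
        show q + 2 + ((n - 1 : ℕ) : ZMod n) = q + 1 by
          simpa using zsh_one q (a := 2) (b := n - 1) (by omega)] at this
    have S2 : m' (q + 2) * Sw l m m' q 1 = l (q + 2) * Sw l m m' q 2 + m (q + 2) * Sw l m m' q 3 := by
      simpa using Sw_colRec l m m' q 1 (by omega)
    have T2 : m (q + 2) * Tw l m m' (q + 3) (n - 3) =
        l (q + 2) * Tw l m m' (q + 2) (n - 2) + m' (q + 2) * Tw l m m' (q + 1) (n - 1) := by
      have := Tw_colRec l m m' (q + 3) (n - 3) (by omega)
      rwa [show (q + 3 - 1 : ZMod n) = q + 2 by ring, show (q + 3 - 2 : ZMod n) = q + 1 by ring,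
        show n - 3 + 1 = n - 2 by omega, show n - 3 + 2 = n - 1 by omega] at this
    have S3 : m' (q + 2) * Sw l m m' (q + 2) 0 =
        l (q + 1) * Sw l m m' (q + 1) 1 + m q * Sw l m m' q 2 := by
      have := Sw_rowRec l m m' (q + 2) 0 (by omega)
      rwa [show (q + 2 - 1 : ZMod n) = q + 1 by ring, show (q + 2 - 2 : ZMod n) = q by ring] at this
    have T3 : m q * Tw l m m' (q + 2) (n - 2) = l (q + 1) * Tw l m m' (q + 2) (n - 1) := by
      have := Tw_rowRec_top l m m' (by omega) (q + 2)
      rwa [show (q + 2 - 2 : ZMod n) = q by ring, show (q + 2 - 1 : ZMod n) = q + 1 by ring] at this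
    have S4 : m' (q + 1) * Sw l m m' q 0 = l (q + 1) * Sw l m m' q 1 + m (q + 1) * Sw l m m' q 2 := by
      simpa using Sw_colRec l m m' q 0 (by omega)
    have T4 : m (q + 1) * Tw l m m' (q + 2) (n - 2) = l (q + 1) * Tw l m m' (q + 1) (n - 1) := by
      have := Tw_colRec_top l m m' (by omega) (q + 2)
      rwa [show (q + 2 - 1 : ZMod n) = q + 1 by ring] at this
    -- the four special multiples
    have hS1 : l q * Sw l m m' q 2 ∈ tanV l m m' := by
      refine mem_of_two_mul_eq h2 (Submodule.add_mem _ (Submodule.sub_mem _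
        (lin_mul_cofF_mem l m m' (hl q) q (q + 2))
        (lin_mul_cofF_mem l m m' (hm (q - 1)) (q - 1) (q + 2)))
        (lin_mul_cofF_mem l m m' (hm' (q + 1)) (q + 1) (q + 2))) ?_
      rw [G0, Gm, Gp]
      linear_combination -S1 + T1
    have hS2 : l (q + 2) * Sw l m m' q 2 ∈ tanV l m m' := by
      refine mem_of_two_mul_eq h2 (Submodule.add_mem _ (Submodule.sub_mem _
        (lin_mul_cofF_mem l m m' (hl (q + 2)) q (q + 2))
        (lin_mul_cofF_mem l m m' (hm (q + 2)) q (q + 3)))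
        (lin_mul_cofF_mem l m m' (hm' (q + 2)) q (q + 1))) ?_
      rw [G0, GJp, GJm]
      linear_combination -S2 + T2
    have hSB : l (q + 1) * Sw l m m' (q + 1) 1 ∈ tanV l m m' := by
      refine mem_of_two_mul_eq h2 (Submodule.add_mem _ (Submodule.sub_mem _
        (lin_mul_cofF_mem l m m' (hl (q + 1)) (q + 1) (q + 2))
        (lin_mul_cofF_mem l m m' (hm q) q (q + 2)))
        (lin_mul_cofF_mem l m m' (hm' (q + 2)) (q + 2) (q + 2))) ?_
      rw [Gp, G0, GJJ]
      linear_combination -S3 + T3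
    have hS3 : m q * Sw l m m' q 2 ∈ tanV l m m' := by
      have : m q * Sw l m m' q 2 =
          m' (q + 2) * cofF l m m' (q + 2) (q + 2) - l (q + 1) * Sw l m m' (q + 1) 1 := by
        rw [GJJ]; linear_combination -S3
      rw [this]
      exact Submodule.sub_mem _ (lin_mul_cofF_mem l m m' (hm' (q + 2)) _ _) hSB
    have hSC : l (q + 1) * Sw l m m' q 1 ∈ tanV l m m' := by
      refine mem_of_two_mul_eq h2 (Submodule.add_mem _ (Submodule.sub_mem _
        (lin_mul_cofF_mem l m m' (hl (q + 1)) q (q + 1))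
        (lin_mul_cofF_mem l m m' (hm (q + 1)) q (q + 2)))
        (lin_mul_cofF_mem l m m' (hm' (q + 1)) q q)) ?_
      rw [GJm, G0, Gii]
      linear_combination -S4 + T4
    have hS4 : m (q + 1) * Sw l m m' q 2 ∈ tanV l m m' := by
      have : m (q + 1) * Sw l m m' q 2 =
          m' (q + 1) * cofF l m m' q q - l (q + 1) * Sw l m m' q 1 := by
        rw [Gii]; linear_combination -S4
      rw [this]
      exact Submodule.sub_mem _ (lin_mul_cofF_mem l m m' (hm' (q + 1)) _ _) hSC
    have hsp := hspan q 2 le_rfl (by omega) hlam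
    simp only [Nat.cast_ofNat, show (2 - 1 : ℕ) = 1 from rfl, Nat.cast_one] at hsp
    exact mul_mem_of_span_four hS1 hS2 hS3 hS4 hsp
  | succ e' ih =>
    intro hn q lam hlam
    set e := 2 * e' + 2 with he
    have hee : 2 * (e' + 1) + 2 = e + 2 := by omega
    rw [hee] at hn ⊢
    have ih' := ih (by omega)
    -- the window `[q, J]`, `J = q + (e+2)`
    have hJ1 : q + ((e + 2 : ℕ) : ZMod n) - 1 = q + ((e + 1 : ℕ) : ZMod n) := by push_cast; ring
    have hJ2 : q + ((e + 2 : ℕ) : ZMod n) - 2 = q + (e : ZMod n) := by push_cast; ring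
    -- (B1) l_q : rows q-1, q, q+1 against column J
    have S1 := Sw_rowRec l m m' (q + 1) (e + 1) (by omega)
    have T1 := Tw_rowRec l m m' (q + ((e + 2 : ℕ) : ZMod n)) (n - (e + 3)) (by omega)
    have hS1 : l q * Sw l m m' q (e + 2) ∈ tanV l m m' := by
      have Gm : cofF l m m' (q - 1) (q + ((e + 2 : ℕ) : ZMod n)) =
          Tw l m m' (q + ((e + 2 : ℕ) : ZMod n)) (n - (e + 3)) + Sw l m m' (q - 1) (e + 3) := by
        have := G (e + 3) (by omega) (by omega) (q - 1)
        rwa [show q - 1 + ((e + 3 : ℕ) : ZMod n) = q + ((e + 2 : ℕ) : ZMod n) by push_cast; ring] at this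
      have Gp : cofF l m m' (q + 1) (q + ((e + 2 : ℕ) : ZMod n)) =
          Tw l m m' (q + ((e + 2 : ℕ) : ZMod n)) (n - (e + 1)) + Sw l m m' (q + 1) (e + 1) := by
        have := G (e + 1) (by omega) (by omega) (q + 1)
        rwa [show q + 1 + ((e + 1 : ℕ) : ZMod n) = q + ((e + 2 : ℕ) : ZMod n) by push_cast; ring] at this
      refine mem_of_two_mul_eq h2 (Submodule.add_mem _ (Submodule.sub_mem _
        (lin_mul_cofF_mem l m m' (hl q) q (q + ((e + 2 : ℕ) : ZMod n)))
        (lin_mul_cofF_mem l m m' (hm (q - 1)) (q - 1) (q + ((e + 2 : ℕ) : ZMod n))))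
        (lin_mul_cofF_mem l m m' (hm' (q + 1)) (q + 1) (q + ((e + 2 : ℕ) : ZMod n)))) ?_
      rw [G (e + 2) (by omega) (by omega), Gm, Gp]
      rw [show q + 1 - 1 = q by ring, show q + 1 - 2 = q - 1 by ring,
        show e + 1 + 1 = e + 2 by ring, show e + 1 + 2 = e + 3 by ring] at S1
      rw [show n - (e + 3) + 1 = n - (e + 2) by omega, show n - (e + 3) + 2 = n - (e + 1) by omega] at T1
      rw [zsh_neg_one q (by omega), zsh_zero q (by omega), zsh_one q (by omega)] at T1
      linear_combination -S1 + T1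
    -- (B2) l_J : columns J-1, J, J+1 against row q
    have S2 := Sw_colRec l m m' q (e + 1) (by omega)
    have T2 := Tw_colRec l m m' (q + ((e + 3 : ℕ) : ZMod n)) (n - (e + 3)) (by omega)
    have hS2 : l (q + ((e + 2 : ℕ) : ZMod n)) * Sw l m m' q (e + 2) ∈ tanV l m m' := by
      refine mem_of_two_mul_eq h2 (Submodule.add_mem _ (Submodule.sub_mem _
        (lin_mul_cofF_mem l m m' (hl (q + ((e + 2 : ℕ) : ZMod n))) q (q + ((e + 2 : ℕ) : ZMod n)))
        (lin_mul_cofF_mem l m m' (hm (q + ((e + 2 : ℕ) : ZMod n))) q (q + ((e + 3 : ℕ) : ZMod n))))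
        (lin_mul_cofF_mem l m m' (hm' (q + ((e + 2 : ℕ) : ZMod n))) q (q + ((e + 1 : ℕ) : ZMod n)))) ?_
      rw [G (e + 2) (by omega) (by omega), G (e + 3) (by omega) (by omega), G (e + 1) (by omega) (by omega)]
      rw [show e + 1 + 1 = e + 2 by ring, show e + 1 + 2 = e + 3 by ring] at S2
      rw [show q + ((e + 3 : ℕ) : ZMod n) - 1 = q + ((e + 2 : ℕ) : ZMod n) by push_cast; ring,
        show q + ((e + 3 : ℕ) : ZMod n) - 2 = q + ((e + 1 : ℕ) : ZMod n) by push_cast; ring,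
        show n - (e + 3) + 1 = n - (e + 2) by omega, show n - (e + 3) + 2 = n - (e + 1) by omega] at T2
      linear_combination -S2 + T2
    -- (B3) m_q : (E) Sw_rowRec at (q+2, e), the IH at q+2, and (B1)-type identity at row q+1
    have S3 := Sw_rowRec l m m' (q + 2) e (by omega)
    have T3 := Tw_rowRec l m m' (q + ((e + 2 : ℕ) : ZMod n)) (n - (e + 2)) (by omega)
    rw [show q + 2 - 1 = q + 1 by ring, show q + 2 - 2 = q by ring] at S3
    have hSB : l (q + 1) * Sw l m m' (q + 1) (e + 1) ∈ tanV l m m' := by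
      have Gp : cofF l m m' (q + 1) (q + ((e + 2 : ℕ) : ZMod n)) =
          Tw l m m' (q + ((e + 2 : ℕ) : ZMod n)) (n - (e + 1)) + Sw l m m' (q + 1) (e + 1) := by
        have := G (e + 1) (by omega) (by omega) (q + 1)
        rwa [show q + 1 + ((e + 1 : ℕ) : ZMod n) = q + ((e + 2 : ℕ) : ZMod n) by push_cast; ring] at this
      have Gpp : cofF l m m' (q + 2) (q + ((e + 2 : ℕ) : ZMod n)) =
          Tw l m m' (q + ((e + 2 : ℕ) : ZMod n)) (n - e) + Sw l m m' (q + 2) e := by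
        have := G e (by omega) (by omega) (q + 2)
        rwa [show q + 2 + (e : ZMod n) = q + ((e + 2 : ℕ) : ZMod n) by push_cast; ring] at this
      refine mem_of_two_mul_eq h2 (Submodule.add_mem _ (Submodule.sub_mem _
        (lin_mul_cofF_mem l m m' (hl (q + 1)) (q + 1) (q + ((e + 2 : ℕ) : ZMod n)))
        (lin_mul_cofF_mem l m m' (hm q) q (q + ((e + 2 : ℕ) : ZMod n))))
        (lin_mul_cofF_mem l m m' (hm' (q + 2)) (q + 2) (q + ((e + 2 : ℕ) : ZMod n)))) ?_
      rw [Gp, G (e + 2) (by omega) (by omega), Gpp]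
      rw [show n - (e + 2) + 1 = n - (e + 1) by omega, show n - (e + 2) + 2 = n - e by omega] at T3
      rw [zsh_zero q (by omega), zsh_one q (by omega), zsh_two q (by omega)] at T3
      linear_combination -S3 + T3
    have hS3 : m q * Sw l m m' q (e + 2) ∈ tanV l m m' := by
      have : m q * Sw l m m' q (e + 2) =
          m' (q + 2) * Sw l m m' (q + 2) e - l (q + 1) * Sw l m m' (q + 1) (e + 1) := by
        linear_combination -S3
      rw [this]
      exact Submodule.sub_mem _ (ih' _ _ (hm' _)) hSB
    -- (B4) m_{J-1} : (E) Sw_colRec at (q, e), the IH at q, and (B2)-type identity at column J-1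
    have S4 := Sw_colRec l m m' q e (by omega)
    have T4 := Tw_colRec l m m' (q + ((e + 2 : ℕ) : ZMod n)) (n - (e + 2)) (by omega)
    have hSC : l (q + ((e + 1 : ℕ) : ZMod n)) * Sw l m m' q (e + 1) ∈ tanV l m m' := by
      refine mem_of_two_mul_eq h2 (Submodule.add_mem _ (Submodule.sub_mem _
        (lin_mul_cofF_mem l m m' (hl (q + ((e + 1 : ℕ) : ZMod n))) q (q + ((e + 1 : ℕ) : ZMod n)))
        (lin_mul_cofF_mem l m m' (hm (q + ((e + 1 : ℕ) : ZMod n))) q (q + ((e + 2 : ℕ) : ZMod n))))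
        (lin_mul_cofF_mem l m m' (hm' (q + ((e + 1 : ℕ) : ZMod n))) q (q + (e : ZMod n)))) ?_
      rw [G (e + 1) (by omega) (by omega), G (e + 2) (by omega) (by omega), G e (by omega) (by omega)]
      rw [hJ1, hJ2, show n - (e + 2) + 1 = n - (e + 1) by omega,
        show n - (e + 2) + 2 = n - e by omega] at T4
      linear_combination -S4 + T4
    have hS4 : m (q + ((e + 1 : ℕ) : ZMod n)) * Sw l m m' q (e + 2) ∈ tanV l m m' := by
      have : m (q + ((e + 1 : ℕ) : ZMod n)) * Sw l m m' q (e + 2) =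
          m' (q + ((e + 1 : ℕ) : ZMod n)) * Sw l m m' q e
            - l (q + ((e + 1 : ℕ) : ZMod n)) * Sw l m m' q (e + 1) := by
        linear_combination -S4
      rw [this]
      exact Submodule.sub_mem _ (ih' _ _ (hm' _)) hSC
    have hsp := hspan q (e + 2) (by omega) (by omega) hlam
    rw [show e + 2 - 1 = e + 1 by omega] at hsp
    exact mul_mem_of_span_four hS1 hS2 hS3 hS4 hsp

end chainS

end

end Summit.ValiantsHypothesis.ValiantsHypothesis.Theorems.ValuativeFlip
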